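import Summits.BirchSwinnertonDyer.Rank1Residual.Additive.QuadraticTwistPadicNoPTorsion
import Summits.BirchSwinnertonDyer.Rank1Residual.Additive.CyclotomicTowerLocalTorsionPadic
import Literature.NumberTheory.EllipticCurves.FormalLeafDenominatorsProofs
import Literature.NumberTheory.EllipticCurves.SerreOpenImageOrdinaryInertiaProofs
import Literature.NumberTheory.LFunctions.WooleySimultaneousCongruences
import HarnessLib

/-!
# The good supersingular `ℤ_p`-model from the consumers' hypotheses (`V` globally minimal, good at
# `p`, `a_p(V) = 0`), and the `htors` hypotheses of the odd `η`-branch DISCHARGED in the consumers'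
# own binders (cell `b2b-bsdres`, CLASS-CLOSURE lane, class O10 — x1b GEN 32, class lead; file 8 of
# the local series p315764 / p316085 / p316474 / p316672)

HONEST FRAMING (cell `b2b-bsdres`, run/shared/lean/b2b/bsd-rank1-residual/, verbatim in every
file): the goal of the cell is to DELETE the COMBINATION-SHAPED residual classes of the
Birch–Swinnerton-Dyer formula for ALL analytic-rank `≤ 1` elliptic curves over `ℚ` — "full BSD
formula for every rank `≤ 1` curve in class `C`" assembled STRICTLY from published theorems — so
that the rank-`≤ 1` remainder becomes exactly the CONSTRUCTION-SHAPED classes, which are TYPED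
(missing-input `Prop`s), NOT attempted. This is not "finishing BSD". CLASS-CLOSURE lane: prove
what is provable now; shrink each hard class to its core with data; no claim beyond stated classes;
research routes on CONSTRUCTION-SHAPED X12 / O10; census / instrument output = EVIDENCE / conjecture
items, NEVER a Literature fact; `RESIDUAL-MAP.md` marks change only by signed lines. THIS FILE:
TOOL THEOREMS ONLY — no definition, no named Literature fact, no Summits-side fact `def`, no
`sorry`, axioms standard; nothing is booked; no label / mark / count / sub-cell moves; O10 stays
OPEN / CONSTRUCTION-SHAPED; nothing about `BSD(W, p)` of any pair is claimed.

## What is proved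

* `intCast_padicInt_mem_maximalIdeal_of_dvd` — integers divisible by `p` lie in `pℤ_p` (units:
  the tree's `Wooley.isUnit_intCast_of_not_dvd`).
* **`exists_goodSupersingularPadicModel`** — for `V/ℚ` elliptic, GLOBALLY MINIMAL, with
  `V.HasGoodReductionAtPrime p`, `V.frobeniusTrace p = 0` and `p ≠ 2`, the integral model
  `integralModelInt V` read in `ℤ_p` is a model `M` with `Δ(M) ∈ ℤ_p^×`
  (`not_dvd_minimalDiscriminantInt_of_hasGoodReductionAtPrime'`, Silverman VII.5.1), Hasse
  coefficient `A_p(M) ∈ pℤ_p` (`a_p ≡ A_p (mod p)`: the tree's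
  `intCast_frobeniusTrace_eq_hasseCoeff`, Silverman V.4.1(a); `map_hasseCoeff`) and
  `M ⊗ ℚ̄_p = V ⊗ ℚ̄_p` (`map_integralModelInt`).
* **`eq_zero_of_prime_smul_eq_zero_padic_of_quadraticTwist_goodSupersingular`** — in the EXACT
  binders of the (C2_η-GZ)/(C3_η) typed inputs and their consumers
  (`C • W.quadraticTwist ((−1)^{p/2} p) = V`, `[V.IsElliptic] [V.IsGloballyMinimal]`,
  `V.HasGoodReductionAtPrime p`, `V.frobeniusTrace p = 0`; `p ≠ 2`):
  **`∀ Q : (W.baseChange ℚ_[p]).toAffine.Point, p • Q = 0 → Q = 0`** — the hypothesis `htors`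
  of `QuadraticBranchOddStrictExactControlOfPlusMCAt`, `QuadraticBranchPAdicGrossZagierValuationAt`,
  `StrictSelmerIndex`, `QuadraticBranchOddStrictSelmerLevel`, … is a THEOREM (file 7 + the model).
* `eq_zero_of_prime_smul_eq_zero_padic_of_goodSupersingular` — `V(ℚ_p)[p] = 0` for `V` itself.
* **`inf_towerSigned_towerSubgroup_eq_top_of_goodSupersingular`**,
  **`eq_zero_of_prime_pow_smul_eq_zero_localFixedPointsOfEmb_towerSubgroup_of_goodSupersingular`** —
  cc-typer-6's tower over `K = ℚ`-style bases: Kobayashi's Prop. 8.7 at every layer and Prop. 8.12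
  ii) (first identity) for `V` globally minimal, good supersingular at `p ≥ 3`, `K₀/K` Galois of
  degree `< (p² − 1)/2` — NO torsion hypothesis, NO model hypothesis (file 6 + the model).

References: [SilvermanAEC2009] V.4.1(a), VII.1.3(b), VII.5.1(a), VIII.8; [SerreInventiones1972]
§1.11 Prop. 12; [Kobayashi2003] Prop. 8.7 (p. 16), Prop. 8.12 ii) (pp. 17–18).
-/

noncomputable section

open scoped Classical

namespace Summit.BirchSwinnertonDyer.Rank1Residual.Additive

open Literature.NumberTheory.EllipticCurves Literature.NumberTheory.GaloisRepresentations
  Literature.NumberTheory.EllipticCurves.Kobayashi2003 ZpExtension WeierstrassCurve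

variable {p : ℕ} [hp : Fact p.Prime]

/-! ## §1 `ℤ → ℤ_p`: the maximal ideal -/

/-- An integer divisible by `p` lies in the maximal ideal `pℤ_p`. [folklore] -/
theorem intCast_padicInt_mem_maximalIdeal_of_dvd {k : ℤ} (hk : (p : ℤ) ∣ k) :
    (k : ℤ_[p]) ∈ IsLocalRing.maximalIdeal ℤ_[p] := by
  rw [PadicInt.maximalIdeal_eq_span_p, Ideal.mem_span_singleton]
  obtain ⟨m, rfl⟩ := hk
  exact ⟨(m : ℤ_[p]), by push_cast; ring⟩

/-! ## §2 The good supersingular `ℤ_p`-model of a globally minimal `V` with `a_p(V) = 0` -/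

/-- **The good supersingular `ℤ_p`-model.** For `V/ℚ` elliptic and globally minimal with good
reduction at `p ≠ 2` and `a_p(V) = 0`, the integral model `M = integralModelInt V ⊗ ℤ_p` has
`Δ(M) ∈ ℤ_p^×` (Silverman VII.5.1(a): `p ∤ Δ_min`), `A_p(M) ∈ pℤ_p` (Silverman V.4.1(a):
`a_p ≡ A_p (mod p)`, the tree's `intCast_frobeniusTrace_eq_hasseCoeff`), and
`M ⊗ ℚ̄_p = V ⊗ ℚ̄_p`. [cite: SilvermanAEC2009, VII.5 Prop. 5.1(a) and V.4 Thm. 4.1(a)] -/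
theorem exists_goodSupersingularPadicModel (hp2 : p ≠ 2) (V : WeierstrassCurve ℚ) [V.IsElliptic]
    [V.IsGloballyMinimal] (hgood : V.HasGoodReductionAtPrime p) (hap : V.frobeniusTrace p = 0) :
    ∃ M : WeierstrassCurve ℤ_[p], IsUnit M.Δ ∧ M.hasseCoeff p ∈ IsLocalRing.maximalIdeal ℤ_[p] ∧
      M.baseChange (AlgebraicClosure ℚ_[p]) = V.baseChange (AlgebraicClosure ℚ_[p]) := by
  have hΔ : ¬ (p : ℤ) ∣ minimalDiscriminantInt V :=
    not_dvd_minimalDiscriminantInt_of_hasGoodReductionAtPrime' V p hgood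
  refine ⟨(integralModelInt V).map (Int.castRingHom ℤ_[p]), ?_, ?_, ?_⟩
  · -- the discriminant is a `p`-adic unit
    rw [map_Δ, eq_intCast]
    exact Literature.NumberTheory.LFunctions.Wooley.isUnit_intCast_of_not_dvd hΔ
  · -- the Hasse coefficient: `A_p ≡ a_p = 0 (mod p)`
    haveI : ((integralModelInt V).map (Int.castRingHom (ZMod p))).IsElliptic := by
      refine ⟨isUnit_iff_ne_zero.mpr ?_⟩
      rw [map_Δ, eq_intCast]
      change ((minimalDiscriminantInt V : ℤ) : ZMod p) ≠ 0
      rwa [Ne, ZMod.intCast_zmod_eq_zero_iff_dvd]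
    have hA : (((integralModelInt V).hasseCoeff p : ℤ) : ZMod p) = 0 := by
      have h := intCast_frobeniusTrace_eq_hasseCoeff V p hp2
      rw [map_hasseCoeff, eq_intCast, hap, Int.cast_zero] at h
      exact h.symm
    rw [map_hasseCoeff, eq_intCast]
    exact intCast_padicInt_mem_maximalIdeal_of_dvd ((ZMod.intCast_zmod_eq_zero_iff_dvd _ p).mp hA)
  · -- both base changes are `integralModelInt V` read in `ℚ̄_p`
    conv_rhs => rw [← map_integralModelInt V]
    rw [WeierstrassCurve.baseChange, WeierstrassCurve.baseChange, WeierstrassCurve.map_map,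
      WeierstrassCurve.map_map]
    congr 1

/-! ## §3 The consumers' `htors` hypothesis is a theorem -/

/-- **`W(ℚ_p)[p] = 0` for the `p*`-twist partner `W` of a good supersingular `V` — in the consumers'
binders.** For `p ≠ 2`, `C • W.quadraticTwist ((−1)^{p/2} p) = V` with `V` elliptic, globally
minimal, `V.HasGoodReductionAtPrime p` and `V.frobeniusTrace p = 0`:
`∀ Q : (W.baseChange ℚ_[p]).toAffine.Point, p • Q = 0 → Q = 0` — the hypothesis `htors` of the
(C2_η-GZ)/(C3_η) typed inputs and of `StrictSelmerIndex` / `QuadraticBranchOddStrictSelmerLevel` /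
`QuadraticBranchPAdicGrossZagierValuation`, now supplied by file 7
(`eq_zero_of_prime_smul_eq_zero_padic_of_quadraticTwist_signedPrime`) and the model of §2.
[cite: SerreInventiones1972, §1.11 Prop. 12] [cite: SilvermanAEC2009, VII.5 Prop. 5.1(a) and V.4 Thm. 4.1(a)] -/
theorem eq_zero_of_prime_smul_eq_zero_padic_of_quadraticTwist_goodSupersingular (hp2 : p ≠ 2)
    (W : WeierstrassCurve ℚ) (C : VariableChange ℚ) (V : WeierstrassCurve ℚ) [V.IsElliptic]
    [V.IsGloballyMinimal] (hCV : C • W.quadraticTwist ((-1) ^ (p / 2) * p) = V)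
    (hgood : V.HasGoodReductionAtPrime p) (hap : V.frobeniusTrace p = 0) :
    ∀ Q : (W.baseChange ℚ_[p]).toAffine.Point, p • Q = 0 → Q = 0 := by
  obtain ⟨M, hΔ, hA, hVM⟩ := exists_goodSupersingularPadicModel hp2 V hgood hap
  exact eq_zero_of_prime_smul_eq_zero_padic_of_quadraticTwist_signedPrime hp2 W C hCV M hΔ hA hVM

/-- **`V(ℚ_p)[p] = 0` for `V` itself**: a globally minimal elliptic `V/ℚ` with good reduction at
`p ≠ 2` and `a_p(V) = 0` has no `ℚ_p`-point of order `p` (the Literature field form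
`eq_zero_of_prime_smul_eq_zero_of_forall_map_eq` with `H = ⊤`, index `1`).
[cite: SerreInventiones1972, §1.11 Prop. 12] -/
theorem eq_zero_of_prime_smul_eq_zero_padic_of_goodSupersingular (hp2 : p ≠ 2)
    (V : WeierstrassCurve ℚ) [V.IsElliptic] [V.IsGloballyMinimal]
    (hgood : V.HasGoodReductionAtPrime p) (hap : V.frobeniusTrace p = 0) :
    ∀ Q : (V.baseChange ℚ_[p]).toAffine.Point, p • Q = 0 → Q = 0 := by
  obtain ⟨M, hΔ, hA, hVM⟩ := exists_goodSupersingularPadicModel hp2 V hgood hap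
  intro Q hpQ
  rcases Q with _ | ⟨x, y, hxy⟩
  · rfl
  exfalso
  let f : ℚ_[p] →ₐ[ℚ] AlgebraicClosure ℚ_[p] := (Algebra.ofId ℚ_[p] _).restrictScalars ℚ
  have hpQA : p • Affine.Point.map f (.some x y hxy : (V.baseChange ℚ_[p]).toAffine.Point) = 0 := by
    rw [← map_nsmul, hpQ, map_zero]
  rw [Affine.Point.map_some] at hpQA
  have h3 : 3 ≤ p := by
    rcases hp.out.eq_two_or_odd' with h | h
    · exact absurd h hp2
    · have := hp.out.two_le; rcases h with ⟨k, hk⟩; omega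
  have h9 : 9 ≤ p ^ 2 := by nlinarith
  exact prime_smul_some_ne_zero_of_forall_apply_eq hp2 M hΔ hA hVM ⊤
    (by rw [Subgroup.index_top]; exact one_ne_zero) (by rw [Subgroup.index_top]; omega)
    (fun σ _ ↦ σ.commutes x) hpQA

/-! ## §4 cc-typer-6's tower for a globally minimal good supersingular `V`: NO hypotheses left but
`hsum` -/

section Tower

variable {K : Type} [Field K] [NumberField K] [Algebra K ℚ_[p]] (κ : ZpExtension K p)
  (K₀ : Type) [Field K₀] [NumberField K₀] [Algebra K K₀] [IsGalois K K₀]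
  [(galRange (K := K) K₀).Normal]
  (ι : AlgebraicClosure K →ₐ[K] AlgebraicClosure ℚ_[p])

/-- **Kobayashi's Prop. 8.7 over the whole tower, for a globally minimal good supersingular `V/ℚ`
read over `K`**: with `W = V ⊗ K` for a number field `K ⊆ ℚ_p` (Kobayashi: `K = ℚ`), `K₀/K` Galois
of degree `< (p² − 1)/2` (Kobayashi: `K₀ = ℚ(μ_p)`), `p ≥ 3`: `E(K_{n,v})[p^k] = 0` for all `n, k`,
provided `W ⊗ ℚ̄_p = V ⊗ ℚ̄_p` (the curve over `K` IS `V`). [cite: Kobayashi2003, Prop. 8.7 (p. 16)] -/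
theorem eq_zero_of_prime_pow_smul_eq_zero_localFixedPointsOfEmb_towerSubgroup_of_goodSupersingular
    (hp2 : p ≠ 2) (V : WeierstrassCurve ℚ) [V.IsElliptic] [V.IsGloballyMinimal]
    (hgood : V.HasGoodReductionAtPrime p) (hap : V.frobeniusTrace p = 0)
    (W : WeierstrassCurve K) [W.IsElliptic]
    (hWV : W.baseChange (AlgebraicClosure ℚ_[p]) = V.baseChange (AlgebraicClosure ℚ_[p]))
    (hK₀ : Module.finrank K K₀ < (p ^ 2 - 1) / 2) (n k : ℕ) :
    ∀ Q ∈ localFixedPointsOfEmb ι W (towerSubgroup κ K₀ n), p ^ k • Q = 0 → Q = 0 := by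
  obtain ⟨M, hΔ, hA, hVM⟩ := exists_goodSupersingularPadicModel hp2 V hgood hap
  exact eq_zero_of_prime_pow_smul_eq_zero_localFixedPointsOfEmb_towerSubgroup_of_finrank_lt κ K₀ ι W
    hp2 M hΔ hA (hVM.trans hWV.symm) hK₀ n k

/-- **Prop. 8.12 ii), first identity, for a globally minimal good supersingular `V/ℚ` read over
`K`, NO torsion / model hypothesis**: `E⁺(K_{n,v}) ∩ E⁻(K_{n,v}) = E(K_{−1,v})` at every layer
`n` of cc-typer-6's tower `K₀·K_n^κ`, `K₀/K` Galois of degree `< (p² − 1)/2`, `p ≥ 3`.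
[cite: Kobayashi2003, Prop. 8.12 ii) (pp. 17–18), Prop. 8.7 (p. 16)] -/
theorem inf_towerSigned_towerSubgroup_eq_top_of_goodSupersingular
    (hp2 : p ≠ 2) (V : WeierstrassCurve ℚ) [V.IsElliptic] [V.IsGloballyMinimal]
    (hgood : V.HasGoodReductionAtPrime p) (hap : V.frobeniusTrace p = 0)
    (W : WeierstrassCurve K) [W.IsElliptic]
    (hWV : W.baseChange (AlgebraicClosure ℚ_[p]) = V.baseChange (AlgebraicClosure ℚ_[p]))
    (hK₀ : Module.finrank K K₀ < (p ^ 2 - 1) / 2) (n : ℕ) :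
    towerSignedLocalPointsOfEmb (towerSubgroup κ K₀) ι W 1 n ⊓
        towerSignedLocalPointsOfEmb (towerSubgroup κ K₀) ι W (-1) n =
      localFixedPointsOfEmb ι W ⊤ := by
  obtain ⟨M, hΔ, hA, hVM⟩ := exists_goodSupersingularPadicModel hp2 V hgood hap
  exact inf_towerSigned_towerSubgroup_eq_top_of_finrank_lt κ K₀ ι W hp2 M hΔ hA
    (hVM.trans hWV.symm) hK₀ n

end Tower

end Summit.BirchSwinnertonDyer.Rank1Residual.Additive

end
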